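import Summits.HodgeConjecture.CorCM.GaloisQuaternionCyclicPrimeDegenerate
import Summits.HodgeConjecture.CorCM.GaloisCyclicSemidirectEightNormPredicate
import Mathlib.NumberTheory.LegendreSymbol.AddCharacter
import Mathlib.RingTheory.RootsOfUnity.Complex
import HarnessLib

/-!
# `Q₈ × C_p` is BAD whenever `ℤ/p` carries a `μ₄`-NORM PAIR (sum of two norm forms) — `Q₈ × C₁₃` is BAD

COR-CM (cell `pub-hodgecm2`), binder seat b04 (gen 28), count-neutral claim QUATERNION-CYCLIC-PRIME-DEGENERATE, part II.  KERNEL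
ONLY: theorems; no definition, no named fact, no `sorry`.  `HC_CM` is neither used nor claimed.

Every CM set of `G₀ = Q₈ × C_p` (`c₀ = (a 2, 1)`) is a pair of `μ₄`-valued SHEETS `k₀, k₁ : ℤ/p → ℤ/4`:
`(a t, v) ∈ T(k₀,k₁)` iff `t ∈ {k₀ v, k₀ v + 1}` and `(xa s, v) ∈ T(k₀,k₁)` iff `−s ∈ {k₁ v, k₁ v + 1}` (so that both sheets of
part I read `{(t,v) : t ∈ {kⱼ v, kⱼ v + 1}}`).  At the odd character `χ₀(t,v) = iᵗ ζᵛ`: `Ŝⱼ(χ₀) = (1+i) Gⱼ`, `Ŝⱼ(χ₀θ) = (1−i) Ḡⱼ`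
with `Gⱼ = Σ_v i^{kⱼ v} ζ^v`, `Ḡⱼ = Σ_v i^{−kⱼ v} ζ^v` (`θ` inverts the `ℤ/4`-factor, so `i ↦ −i` but `ζ` is FIXED), `χ₀(c₀) = −1`, and
`Δ(χ₀) = 2·(G₀Ḡ₀ + G₁Ḡ₁)` — the sum of two norm forms `P² + Q²` of gen 25.  Coefficient of `ζ^d` in `GⱼḠⱼ`:
`cⱼ(d) = Σ_v i^{kⱼ(v) − kⱼ(d − v)} = Σ_r Mⱼ(d,r) i^r`, `Mⱼ(d,r) = #{v : kⱼ v − kⱼ(d − v) = r}`.  A **`μ₄`-norm pair for `Q₈ × C_p`**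
is `(k₀, k₁)` with `k₀` non-constant and `c₀(d) + c₁(d)` independent of `d` — two balance identities on the counts `M`, checked by
`decide` on `ℤ/p` alone; then the block is singular and (part I) **`K` with `Gal(K/ℚ) ≅ Q₈ × C_p` has a simple DEGENERATE CM abelian
`4p`-fold** (`exists_simple_degenerate_of_normPair`; primitivity is automatic: an even left stabiliser `(a t₀, v₀)` forces
`k(v₀+v) = k(v) + t₀`, so `p t₀ = 0`; an odd one `(xa s₀, v₀)` forces `k₁(2v₀ + v) = k₁(v) − 2`, so `2p = 0` in `ℤ/4`).
No two-valued pair exists (that would put `√−1` or `√−2` in `ℚ(ζ_p)`), and by gen 25 none at all when `ord_p 2` is odd; the PB-SAT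
search of this seat (`jobs/q8sat`, seconds per prime) finds pairs for `p = 3, 5, 11` (the known certificates) and **`p = 13`**
(`ord₁₃ 2 = 12`): part III `CorCM/GaloisQuaternionCyclicPrimeNormPairCertificates`.

## References

* [Kubota1965] T. Kubota, *On the field extension by complex multiplication*, Trans. AMS 118 (1965), §2, §4 Lemma 2.
* [Shimura1998] G. Shimura, *Abelian Varieties with Complex Multiplication and Modular Functions*, §6.2 Thm. 3, §8.2 Prop. 26.
* [Gordon1999HodgeAVSurvey] B. B. Gordon, *A survey of the Hodge conjecture for abelian varieties*, Thm. 6.4, §9.3, Prop. 9.4.1.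
-/

noncomputable section

open CategoryTheory CategoryTheory.Limits NumberField
open scoped BigOperators

namespace Summit.HodgeConjecture.CorCM.GaloisQuaternionCyclic

open Literature.NumberTheory.ComplexMultiplication
open Literature.AlgebraicGeometry.Motives (AbelianVariety CMType)
open Literature.AlgebraicGeometry.HodgeTheory
open Literature.AlgebraicGeometry.ComplexMultiplication (IsCMTypeRealisation)
open Literature.AlgebraicGeometry.Pohlmann1968
open Literature.Barriers.HodgeConjecture (divisorClassesSpan)
open Summit.HodgeConjecture.CorCM.GaloisCyclicSemidirectEight (apply_eq_apply_of_forall_add)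
open QuaternionGroup AddChar
open Multiplicative (ofAdd toAdd)

/-! ## §1 Bookkeeping on `ℤ/4` (by `decide`) -/

/-- CM set for `c₀ = (a 2, 1)` on both sheets; adjacent pairs `{x, x+1}` in `ℤ/4` determine `x`; `x ≠ x + 1`. [folklore] -/
theorem quatPred_basic : ∀ x c : ZMod 4,
    ((2 + x = c ∨ 2 + x = c + 1) ↔ ¬ (x = c ∨ x = c + 1)) ∧
    ((x - 2 = -c ∨ x - 2 = -c - 1) ↔ ¬ (x = -c ∨ x = -c - 1)) ∧
    ((-x = -c ∨ -x = -c - 1) ↔ (x = c ∨ x = c + 1)) ∧ x ≠ x + 1 := by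
  decide

/-- An even left stabiliser `(a t₀, v₀)` shifts a sheet: `t₀ + x = c`. [folklore] -/
theorem quatPred_even_shift : ∀ t₀ x c : ZMod 4,
    (t₀ + x = c ∨ t₀ + x = c + 1) → (t₀ + (x + 1) = c ∨ t₀ + (x + 1) = c + 1) → t₀ + x = c := by
  decide

/-- An odd left stabiliser `(xa s₀, v₀)`: images of the `a`-sheet (`s₀ + x = −d − 1`) and of the `xa`-sheet
(`2 + (−d−1) − s₀ = c`). [folklore] -/
theorem quatPred_odd : ∀ s₀ x c d : ZMod 4,
    ((s₀ + x = -d ∨ s₀ + x = -d - 1) → (s₀ + (x + 1) = -d ∨ s₀ + (x + 1) = -d - 1) → s₀ + x = -d - 1) ∧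
    ((2 + -d - s₀ = c ∨ 2 + -d - s₀ = c + 1) → (2 + (-d - 1) - s₀ = c ∨ 2 + (-d - 1) - s₀ = c + 1) →
      2 + (-d - 1) - s₀ = c) := by
  decide

/-! ## §2 The theorem -/

section Field

variable {p : ℕ} [Fact p.Prime]
variable {K : Type} [Field K] [NumberField K] [IsCMField K] [IsGalois ℚ K]

/-- **A `μ₄`-NORM PAIR IN `ℤ/p` MAKES `Q₈ × C_p` BAD.**  `e : Gal(K/ℚ) ≃* Q₈ × C_p` (`p` an odd prime); sheets
`k₀, k₁ : ℤ/p → ℤ/4` with `k₀` not constant and, with `Mⱼ(d,r) = #{v : kⱼ v − kⱼ (d − v) = r}`, the balance identities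
`M₀(d,0) + M₁(d,0) + M₀(0,2) + M₁(0,2) = M₀(0,0) + M₁(0,0) + M₀(d,2) + M₁(d,2)` and
`M₀(d,1) + M₁(d,1) + M₀(0,3) + M₁(0,3) = M₀(0,1) + M₁(0,1) + M₀(d,3) + M₁(d,3)` for every `d`.  Then `K` has a PRIMITIVE
DEGENERATE CM type realised by a SIMPLE abelian variety of dimension `4p` with CM by `K` and a rational `(q,q)` class outside the
divisor ring on some power. [cite: Kubota1965, §2 and §4 Lemma 2] [cite: Shimura1998, §6.2 Thm. 3 and §8.2 Prop. 26]
[cite: Gordon1999HodgeAVSurvey, Thm. 6.4 and §9.3] -/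
theorem exists_simple_degenerate_of_normPair (hp2 : p ≠ 2)
    (e : (K ≃ₐ[ℚ] K) ≃* QuaternionGroup 2 × Multiplicative (ZMod p))
    (k₀ k₁ : ZMod p → ZMod 4) (hk : ∃ v, k₀ v ≠ k₀ 0)
    (hR : ∀ d : ZMod p,
      (Finset.univ.filter fun v => k₀ v - k₀ (d - v) = 0).card +
            (Finset.univ.filter fun v => k₁ v - k₁ (d - v) = 0).card +
          (Finset.univ.filter fun v => k₀ v - k₀ (0 - v) = 2).card + (Finset.univ.filter fun v => k₁ v - k₁ (0 - v) = 2).card =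
        (Finset.univ.filter fun v => k₀ v - k₀ (0 - v) = 0).card + (Finset.univ.filter fun v => k₁ v - k₁ (0 - v) = 0).card +
            (Finset.univ.filter fun v => k₀ v - k₀ (d - v) = 2).card +
          (Finset.univ.filter fun v => k₁ v - k₁ (d - v) = 2).card)
    (hI : ∀ d : ZMod p,
      (Finset.univ.filter fun v => k₀ v - k₀ (d - v) = 1).card +
            (Finset.univ.filter fun v => k₁ v - k₁ (d - v) = 1).card +
          (Finset.univ.filter fun v => k₀ v - k₀ (0 - v) = 3).card + (Finset.univ.filter fun v => k₁ v - k₁ (0 - v) = 3).card =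
        (Finset.univ.filter fun v => k₀ v - k₀ (0 - v) = 1).card + (Finset.univ.filter fun v => k₁ v - k₁ (0 - v) = 1).card +
            (Finset.univ.filter fun v => k₀ v - k₀ (d - v) = 3).card +
          (Finset.univ.filter fun v => k₁ v - k₁ (d - v) = 3).card) :
    ∃ (Φ : CMType K) (φ₀ : K →+* ℂ) (A : AbelianVariety ℂ) (ι : 𝓞 K →+* End A)
      (θ : K →+* Module.End ℂ (complexBetti A.X 1)),
      IsPrimitive (ℂ ≃+* ℂ) Φ.1 φ₀ ∧ ¬ IsNondegenerate Φ ∧ IsCMTypeRealisation Φ A ι θ ∧ A.IsSimple ∧ A.dim = 4 * p ∧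
      ∃ n q : ℕ, ∃ x : complexBetti (⨁ fun _ : Fin n => A).X (2 * q), IsRationalClass x ∧
        IsOfHodgeType (⨁ fun _ : Fin n => A).dim (⨁ fun _ : Fin n => A).X (2 * q) q q x ∧
        x ∉ divisorClassesSpan (⨁ fun _ : Fin n => A).X (⨁ fun _ : Fin n => A).dim q := by
  classical
  have hp : p.Prime := Fact.out
  haveI : NeZero p := ⟨hp.ne_zero⟩
  haveI : Fact (1 < p) := ⟨hp.one_lt⟩
  obtain ⟨v₁, hv₁⟩ := hk
  have hpodd : Odd p := hp.odd_of_ne_two hp2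
  -- the CM set `T(k₀, k₁)`
  set T : Finset (QuaternionGroup 2 × Multiplicative (ZMod p)) := Finset.univ.filter fun g =>
    match g.1 with
    | a t => t = k₀ (toAdd g.2) ∨ t = k₀ (toAdd g.2) + 1
    | xa s => s = -k₁ (toAdd g.2) ∨ s = -k₁ (toAdd g.2) - 1 with hT_def
  have hTa : ∀ (t : ZMod 4) (x : Multiplicative (ZMod p)),
      ((a t, x) : QuaternionGroup 2 × Multiplicative (ZMod p)) ∈ T ↔ t = k₀ (toAdd x) ∨ t = k₀ (toAdd x) + 1 := fun t x => by
    rw [hT_def, Finset.mem_filter]; simp only [Finset.mem_univ, true_and]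
  have hTx : ∀ (s : ZMod 4) (x : Multiplicative (ZMod p)),
      ((xa s, x) : QuaternionGroup 2 × Multiplicative (ZMod p)) ∈ T ↔ s = -k₁ (toAdd x) ∨ s = -k₁ (toAdd x) - 1 := fun s x => by
    rw [hT_def, Finset.mem_filter]; simp only [Finset.mem_univ, true_and]
  -- (a) CM set for `c₀ = (a 2, 1)`
  have hScm : ∀ g, g ∈ T ↔ ((a 2, 1) : QuaternionGroup 2 × Multiplicative (ZMod p)) * g ∉ T := by
    rintro ⟨q | q, x⟩
    · rw [Prod.mk_mul_mk, a_mul_a, one_mul, hTa, hTa, (quatPred_basic q _).1, not_not]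
    · rw [Prod.mk_mul_mk, a_mul_xa, one_mul, hTx, hTx, (quatPred_basic q _).2.1, not_not]
  -- (b) trivial left stabiliser
  have hunit4 : IsUnit (p : ZMod 4) := by
    rw [ZMod.isUnit_iff_coprime]
    exact (Nat.coprime_primes hp (by norm_num)).2 hp2 |>.pow_right 2
  have hprim : ∀ g : QuaternionGroup 2 × Multiplicative (ZMod p), g ≠ 1 → ∃ w, ¬ (w ∈ T ↔ g * w ∈ T) := by
    rintro ⟨q₀ | s₀, v₀⟩ hg <;> by_contra hall <;> push Not at hall
    · -- even: `k₀(v₀ + v) = q₀ + k₀(v)`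
      have hshift : ∀ v : ZMod p, q₀ + k₀ v = k₀ (toAdd v₀ + v) := fun v => by
        have h1 := (hall (a (k₀ v), ofAdd v)).1 ((hTa _ _).2 (Or.inl (by rw [toAdd_ofAdd])))
        have h2 := (hall (a (k₀ v + 1), ofAdd v)).1 ((hTa _ _).2 (Or.inr (by rw [toAdd_ofAdd])))
        rw [Prod.mk_mul_mk, a_mul_a, hTa, toAdd_mul, toAdd_ofAdd] at h1 h2
        exact quatPred_even_shift _ _ _ h1 h2
      have hsum : ∑ v : ZMod p, (q₀ + k₀ v) = ∑ v : ZMod p, k₀ v := by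
        rw [Finset.sum_congr rfl fun v _ => hshift v]
        exact Fintype.sum_equiv (Equiv.addLeft (toAdd v₀)) _ _ fun v => rfl
      rw [Finset.sum_add_distrib, Finset.sum_const, Finset.card_univ, ZMod.card, add_eq_right, nsmul_eq_mul] at hsum
      have hq : q₀ = 0 := (hunit4.mul_right_eq_zero).1 hsum
      have hper : ∀ v, k₀ (toAdd v₀ + v) = k₀ v := fun v => by rw [← hshift v, hq, zero_add]
      by_cases hv : toAdd v₀ = 0
      · apply hg
        rw [hq, show v₀ = 1 by rw [← ofAdd_toAdd v₀, hv]; rfl]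
        rfl
      · exact hv₁ (apply_eq_apply_of_forall_add k₀ hv hper v₁ 0)
    · -- odd: `k₁(2v₀ + x) = k₁(x) − 2`, summing gives `2p = 0` in `ℤ/4`
      have hA : ∀ v : ZMod p, s₀ + k₀ v = -k₁ (toAdd v₀ + v) - 1 := fun v => by
        have h1 := (hall (a (k₀ v), ofAdd v)).1 ((hTa _ _).2 (Or.inl (by rw [toAdd_ofAdd])))
        have h2 := (hall (a (k₀ v + 1), ofAdd v)).1 ((hTa _ _).2 (Or.inr (by rw [toAdd_ofAdd])))
        rw [Prod.mk_mul_mk, xa_mul_a, hTx, toAdd_mul, toAdd_ofAdd] at h1 h2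
        exact (quatPred_odd _ _ (0 : ZMod 4) _).1 h1 h2
      have hB : ∀ x : ZMod p, 2 + (-k₁ x - 1) - s₀ = k₀ (toAdd v₀ + x) := fun x => by
        have h1 := (hall (xa (-k₁ x), ofAdd x)).1 ((hTx _ _).2 (Or.inl (by rw [toAdd_ofAdd])))
        have h2 := (hall (xa (-k₁ x - 1), ofAdd x)).1 ((hTx _ _).2 (Or.inr (by rw [toAdd_ofAdd])))
        rw [Prod.mk_mul_mk, xa_mul_xa, hTa, toAdd_mul, toAdd_ofAdd] at h1 h2
        exact (quatPred_odd _ (0 : ZMod 4) _ _).2 h1 h2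
      have hC : ∀ x : ZMod p, k₁ (toAdd v₀ + toAdd v₀ + x) = k₁ x - 2 := fun x => by
        have h := hA (toAdd v₀ + x)
        rw [← hB x, ← add_assoc] at h
        linear_combination h
      have hsum : ∑ x : ZMod p, k₁ (toAdd v₀ + toAdd v₀ + x) = ∑ x : ZMod p, k₁ x :=
        Fintype.sum_equiv (Equiv.addLeft (toAdd v₀ + toAdd v₀)) _ _ fun x => rfl
      rw [Finset.sum_congr rfl fun x _ => hC x, Finset.sum_sub_distrib, Finset.sum_const, Finset.card_univ, ZMod.card,
        sub_eq_self, nsmul_eq_mul] at hsum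
      have h2 : (2 : ZMod 4) = 0 := (hunit4.mul_right_eq_zero).1 hsum
      exact absurd h2 (by decide)
  -- (c) the sheets: graphs of `kⱼ`, `kⱼ + 1`
  set gr : (ZMod p → ZMod 4) → Finset (Multiplicative (ZMod 4) × Multiplicative (ZMod p)) := fun k =>
    Finset.univ.map ⟨fun v => (ofAdd (k v), ofAdd v), fun v w h => by simpa using congrArg Prod.snd h⟩ with hgr_def
  have hgr : ∀ (k : ZMod p → ZMod 4) (t : Multiplicative (ZMod 4)) (x : Multiplicative (ZMod p)),
      (t, x) ∈ gr k ↔ toAdd t = k (toAdd x) := fun k t x => by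
    simp only [hgr_def, Finset.mem_map, Finset.mem_univ, true_and, Function.Embedding.coeFn_mk, Prod.mk.injEq]
    constructor
    · rintro ⟨w, h1, h2⟩
      rw [← h1, ← h2, toAdd_ofAdd, toAdd_ofAdd]
    · intro h
      exact ⟨toAdd x, by rw [← h, ofAdd_toAdd], ofAdd_toAdd x⟩
  have hgr_sum : ∀ (k : ZMod p → ZMod 4) (f : Multiplicative (ZMod 4) × Multiplicative (ZMod p) → ℂ),
      ∑ w ∈ gr k, f w = ∑ v : ZMod p, f (ofAdd (k v), ofAdd v) := fun k f => by
    rw [hgr_def, Finset.sum_map]; rfl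
  have hgr_disj : ∀ k : ZMod p → ZMod 4, Disjoint (gr k) (gr fun v => k v + 1) := fun k => by
    rw [Finset.disjoint_left]
    rintro ⟨t, x⟩ h1 h2
    rw [hgr] at h1 h2
    exact (quatPred_basic (k (toAdd x)) 0).2.2.2 (h1.symm.trans h2)
  set S₁ : Finset (Multiplicative (ZMod 4) × Multiplicative (ZMod p)) := gr k₀ ∪ gr (fun v => k₀ v + 1) with hS₁_def
  set S₂ : Finset (Multiplicative (ZMod 4) × Multiplicative (ZMod p)) := gr k₁ ∪ gr (fun v => k₁ v + 1) with hS₂_def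
  have hS₁ : ∀ (t : Multiplicative (ZMod 4)) (x : Multiplicative (ZMod p)), (t, x) ∈ S₁ ↔
      ((a (toAdd t), x) : QuaternionGroup 2 × Multiplicative (ZMod p)) ∈ T := fun t x => by
    rw [hTa, hS₁_def, Finset.mem_union, hgr, hgr]
  have hS₂ : ∀ (t : Multiplicative (ZMod 4)) (x : Multiplicative (ZMod p)), (t, x) ∈ S₂ ↔
      ((a (toAdd t), x) : QuaternionGroup 2 × Multiplicative (ZMod p)) * (xa 0, 1) ∈ T := fun t x => by
    rw [Prod.mk_mul_mk, a_mul_xa, mul_one, zero_sub, hTx, (quatPred_basic _ _).2.2.1, hS₂_def, Finset.mem_union, hgr, hgr]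
  -- (d) the odd character `χ₀ = (iᵗ ζᵛ)` and its sheet sums
  have hζ : IsPrimitiveRoot (Complex.exp (2 * Real.pi * Complex.I / p)) p := Complex.isPrimitiveRoot_exp p hp.ne_zero
  set ψp : AddChar (ZMod p) ℂ := AddChar.zmodChar p hζ.pow_eq_one with hψp_def
  have hψp1 : ψp ≠ 1 := by
    intro h
    have h1 : ψp 1 = 1 := by rw [h, AddChar.one_apply]
    rw [hψp_def, AddChar.zmodChar_apply, ZMod.val_one, pow_one] at h1
    exact hζ.ne_one hp.one_lt h1
  have hsumψ : ∑ a : ZMod p, ψp a = 0 := AddChar.sum_eq_zero_of_ne_one hψp1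
  set ψ4 : AddChar (ZMod 4) ℂ := AddChar.zmodChar 4 Complex.I_pow_four with hψ4_def
  have hψ4v : ψ4 0 = 1 ∧ ψ4 1 = Complex.I ∧ ψ4 2 = -1 ∧ ψ4 3 = -Complex.I := by
    refine ⟨by rw [map_zero_eq_one], ?_, ?_, ?_⟩ <;> rw [hψ4_def, AddChar.zmodChar_apply]
    · rw [show (1 : ZMod 4).val = 1 from rfl, pow_one]
    · rw [show (2 : ZMod 4).val = 2 from rfl, Complex.I_sq]
    · rw [show (3 : ZMod 4).val = 3 from rfl, pow_succ, Complex.I_sq]; ring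
  let χ₀ : AddChar (Additive (Multiplicative (ZMod 4) × Multiplicative (ZMod p))) ℂ :=
    { toFun := fun w => ψ4 (toAdd (Additive.toMul w).1) * ψp (toAdd (Additive.toMul w).2)
      map_zero_eq_one' := by simp
      map_add_eq_mul' := fun w w' => by
        simp only [toMul_add, Prod.fst_mul, Prod.snd_mul, toAdd_mul, map_add_eq_mul]; ring }
  have hχ₀ : ∀ (t : Multiplicative (ZMod 4)) (x : Multiplicative (ZMod p)),
      χ₀ (Additive.ofMul (t, x)) = ψ4 (toAdd t) * ψp (toAdd x) := fun t x => rfl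
  have hχc : χ₀ (Additive.ofMul (ofAdd (2 : ZMod 4), (1 : Multiplicative (ZMod p)))) = -1 := by
    rw [hχ₀, toAdd_ofAdd, toAdd_one, hψ4v.2.2.1, map_zero_eq_one, mul_one]
  -- sheet sums `Ŝⱼ(χ₀) = (1 + i) Gⱼ`, `Ŝⱼ(χ₀θ) = (1 − i) Ḡⱼ`
  have hsheet : ∀ (k : ZMod p → ZMod 4) (η : ZMod p → ℂ),
      ∑ w ∈ gr k ∪ gr (fun v => k v + 1), ψ4 (toAdd w.1) * η (toAdd w.2) =
      (1 + Complex.I) * ∑ v : ZMod p, ψ4 (k v) * η v := fun k η => by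
    rw [Finset.sum_union (hgr_disj k), hgr_sum, hgr_sum, Finset.mul_sum, ← Finset.sum_add_distrib]
    refine Finset.sum_congr rfl fun v _ => ?_
    simp only [toAdd_ofAdd]
    rw [map_add_eq_mul, hψ4v.2.1]; ring
  have hsheet' : ∀ (k : ZMod p → ZMod 4) (η : ZMod p → ℂ),
      ∑ w ∈ gr k ∪ gr (fun v => k v + 1), ψ4 (-toAdd w.1) * η (toAdd w.2) =
      (1 - Complex.I) * ∑ v : ZMod p, ψ4 (-k v) * η v := fun k η => by
    rw [Finset.sum_union (hgr_disj k), hgr_sum, hgr_sum, Finset.mul_sum, ← Finset.sum_add_distrib]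
    refine Finset.sum_congr rfl fun v _ => ?_
    simp only [toAdd_ofAdd]
    rw [neg_add, show (-1 : ZMod 4) = 3 from rfl, map_add_eq_mul, hψ4v.2.2.2]; ring
  have eA : ∑ s ∈ S₁, χ₀ (Additive.ofMul s) = ∑ w ∈ S₁, ψ4 (toAdd w.1) * ψp (toAdd w.2) :=
    Finset.sum_congr rfl fun w _ => hχ₀ w.1 w.2
  have eAθ : ∑ s ∈ S₁, χ₀ (Additive.ofMul (s.1⁻¹, s.2)) = ∑ w ∈ S₁, ψ4 (-toAdd w.1) * ψp (toAdd w.2) :=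
    Finset.sum_congr rfl fun w _ => by rw [hχ₀, toAdd_inv]
  have eB : ∑ t ∈ S₂, χ₀ (Additive.ofMul t) = ∑ w ∈ S₂, ψ4 (toAdd w.1) * ψp (toAdd w.2) :=
    Finset.sum_congr rfl fun w _ => hχ₀ w.1 w.2
  have eBθ : ∑ t ∈ S₂, χ₀ (Additive.ofMul (t.1⁻¹, t.2)) = ∑ w ∈ S₂, ψ4 (-toAdd w.1) * ψp (toAdd w.2) :=
    Finset.sum_congr rfl fun w _ => by rw [hχ₀, toAdd_inv]
  -- (e) the coefficient of `ζ^d`: `cⱼ(d) = Σ_v ψ4 (kⱼ v − kⱼ (d − v)) = Σ_r Mⱼ(d,r) i^r`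
  have hC : ∀ k : ZMod p → ZMod 4, (∑ v : ZMod p, ψ4 (k v) * ψp v) * (∑ v : ZMod p, ψ4 (-k v) * ψp v) =
      ∑ d : ZMod p, (∑ v : ZMod p, ψ4 (k v - k (d - v))) * ψp d := fun k => by
    rw [Finset.sum_mul_sum]
    have e1 : ∀ v : ZMod p, ∑ w : ZMod p, ψ4 (k v) * ψp v * (ψ4 (-k w) * ψp w) =
        ∑ d : ZMod p, ψ4 (k v - k (d - v)) * ψp d := fun v => by
      refine Fintype.sum_equiv (Equiv.addLeft v) _ _ fun w => ?_
      simp only [Equiv.coe_addLeft, sub_eq_add_neg, map_add_eq_mul]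
      ring
    simp_rw [e1]
    rw [Finset.sum_comm]
    refine Finset.sum_congr rfl fun d _ => ?_
    rw [Finset.sum_mul]
  have hN : ∀ (k : ZMod p → ZMod 4) (d : ZMod p), ∑ v : ZMod p, ψ4 (k v - k (d - v)) =
      ∑ r : ZMod 4, ((Finset.univ.filter fun v => k v - k (d - v) = r).card : ℂ) * ψ4 r := fun k d => by
    rw [← Finset.sum_fiberwise' Finset.univ (fun v => k v - k (d - v)) (fun r => ψ4 r)]
    refine Finset.sum_congr rfl fun r _ => ?_
    rw [Finset.sum_const, nsmul_eq_mul]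
  have h4sum : ∀ f : ZMod 4 → ℂ, ∑ r : ZMod 4, f r = f 0 + f 1 + f 2 + f 3 := fun f => by
    rw [show (Finset.univ : Finset (ZMod 4)) = {0, 1, 2, 3} from rfl]
    rw [Finset.sum_insert (by decide), Finset.sum_insert (by decide), Finset.sum_insert (by decide), Finset.sum_singleton]
    ring
  have hconst : ∀ d : ZMod p, (∑ v : ZMod p, ψ4 (k₀ v - k₀ (d - v))) + (∑ v : ZMod p, ψ4 (k₁ v - k₁ (d - v))) =
      (∑ v : ZMod p, ψ4 (k₀ v - k₀ (0 - v))) + (∑ v : ZMod p, ψ4 (k₁ v - k₁ (0 - v))) := fun d => by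
    rw [hN, hN, hN, hN, h4sum, h4sum, h4sum, h4sum, hψ4v.1, hψ4v.2.1, hψ4v.2.2.1, hψ4v.2.2.2]
    have hR' : (((Finset.univ.filter fun v => k₀ v - k₀ (d - v) = 0).card : ℕ) : ℂ) +
        ((Finset.univ.filter fun v => k₁ v - k₁ (d - v) = 0).card : ℂ) +
        ((Finset.univ.filter fun v => k₀ v - k₀ (0 - v) = 2).card : ℂ) +
        ((Finset.univ.filter fun v => k₁ v - k₁ (0 - v) = 2).card : ℂ) =
        ((Finset.univ.filter fun v => k₀ v - k₀ (0 - v) = 0).card : ℂ) +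
        ((Finset.univ.filter fun v => k₁ v - k₁ (0 - v) = 0).card : ℂ) +
        ((Finset.univ.filter fun v => k₀ v - k₀ (d - v) = 2).card : ℂ) +
        ((Finset.univ.filter fun v => k₁ v - k₁ (d - v) = 2).card : ℂ) := by exact_mod_cast hR d
    have hI' : (((Finset.univ.filter fun v => k₀ v - k₀ (d - v) = 1).card : ℕ) : ℂ) +
        ((Finset.univ.filter fun v => k₁ v - k₁ (d - v) = 1).card : ℂ) +
        ((Finset.univ.filter fun v => k₀ v - k₀ (0 - v) = 3).card : ℂ) +
        ((Finset.univ.filter fun v => k₁ v - k₁ (0 - v) = 3).card : ℂ) =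
        ((Finset.univ.filter fun v => k₀ v - k₀ (0 - v) = 1).card : ℂ) +
        ((Finset.univ.filter fun v => k₁ v - k₁ (0 - v) = 1).card : ℂ) +
        ((Finset.univ.filter fun v => k₀ v - k₀ (d - v) = 3).card : ℂ) +
        ((Finset.univ.filter fun v => k₁ v - k₁ (d - v) = 3).card : ℂ) := by exact_mod_cast hI d
    linear_combination hR' + Complex.I * hI'
  have hAB : (∑ v : ZMod p, ψ4 (k₀ v) * ψp v) * (∑ v : ZMod p, ψ4 (-k₀ v) * ψp v) +
      (∑ v : ZMod p, ψ4 (k₁ v) * ψp v) * (∑ v : ZMod p, ψ4 (-k₁ v) * ψp v) = 0 := by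
    rw [hC, hC, ← Finset.sum_add_distrib]
    have e2 : ∀ d : ZMod p, (∑ v : ZMod p, ψ4 (k₀ v - k₀ (d - v))) * ψp d +
        (∑ v : ZMod p, ψ4 (k₁ v - k₁ (d - v))) * ψp d =
        ((∑ v : ZMod p, ψ4 (k₀ v - k₀ (0 - v))) + (∑ v : ZMod p, ψ4 (k₁ v - k₁ (0 - v)))) * ψp d := fun d => by
      rw [← hconst d]; ring
    simp_rw [e2]
    rw [← Finset.mul_sum, hsumψ, mul_zero]
  -- (f) the singular block
  have hΔ : (∑ s ∈ S₁, χ₀ (Additive.ofMul s)) * (∑ s ∈ S₁, χ₀ (Additive.ofMul (s.1⁻¹, s.2))) -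
      χ₀ (Additive.ofMul (ofAdd (2 : ZMod 4), (1 : Multiplicative (ZMod p)))) *
        ((∑ t ∈ S₂, χ₀ (Additive.ofMul t)) * (∑ t ∈ S₂, χ₀ (Additive.ofMul (t.1⁻¹, t.2)))) = 0 := by
    rw [eA, eAθ, eB, eBθ, hχc, hS₁_def, hS₂_def, hsheet k₀ (fun v => ψp v), hsheet' k₀ (fun v => ψp v),
      hsheet k₁ (fun v => ψp v), hsheet' k₁ (fun v => ψp v)]
    linear_combination (1 + Complex.I) * (1 - Complex.I) * hAB
  exact exists_simple_degenerate_of_singular_block hp2 e T hScm hprim S₁ S₂ (fun w => hS₁ w.1 w.2) (fun w => hS₂ w.1 w.2)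
    χ₀ hχc hΔ

end Field

end Summit.HodgeConjecture.CorCM.GaloisQuaternionCyclic

end
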